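import Literature.IUT.HodgeTheaters.PuncturedEllipticCoveringsArrowClaimsOfModLCuspLaws
import Literature.IUT.HodgeTheaters.PuncturedEllipticCoveringsZeroCuspRamified
import Literature.IUT.HodgeTheaters.InitialThetaDataLocalGroupsOpenProofs
import HarnessLib

/-!
# [IUTchI] §1 p. 38 — openness of `Π_{X̲→}`, `Π_{C̲→}` and the `ε⁰` clause FROM `ModLCuspLaws` (corollaries)

Mochizuki, *Inter-universal Teichmüller theory I*, kurims manuscript (May 2020), §1 p. 38, Cor. 1.2 p. 39,
Def. 3.1 (f) p. 63 [cite: Mochizuki2012, IUTchI §1 p.38] (D-0012 claim key, status disputed).  PROOF-ONLY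
corollaries of the «hA re-grounding» assembly `PuncturedEllipticCoveringsArrowClaimsOfModLCuspLaws.lean`
(p448117; abc-iut-L5-lead RULINGS #58 (10) GO).  No `def`, no instance, no new `Prop` fact.

* **`ArrowOpenClaims` from the laws, WITHOUT [AbsTopI] Prop. 2.2**: w5-d158's `isOpen_piXarrow_of` /
  `isOpen_piCarrow_of` (p424558) need `jKer ⊴ Π_C̲`, `[Π_C̲ : Π_{X̲→}] ≠ 0`, `[Δ_X̲ : Ker(Δ_X̲ ↠ Δ_X̲^{ab} ⊗ ℤ/l)]
  ≠ 0` and `D_{2ε}` closed — the first two are clauses DERIVED from `ModLCuspLaws` (B1, B4), the third IS law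
  (L0), the fourth is `CuspGalois.isClosed_decomp`.  Hence `CuspGalois.arrowOpenClaims_of_modLCuspLaws` and, at an
  initial Θ-datum, `InitialThetaData.arrowOpenClaims_pe_of_modLCuspLaws`, `….isOpen_PiXarrow_of_modLCuspLaws`
  (Def. 3.1 (f) "open subgroups `Π_{X̲→_K}`" — the binder `hX` of G-L5t2g4-1 / Ex. 3.3 at the datum) — the
  binders `(hA, hΔ : GeomTFG)` of `isOpen_PiXarrow_of_cuspGalois` (p427269) replaced by `(h : ModLCuspLaws)`.
* **The `ε⁰` clause of Cor. 1.2** (`¬ I_{ε⁰} ⊆ Π_{X̲→}`, GAP G-L5d4g6-1 binder `h0`): abc-iut-L5-t1 gen 4's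
  `ArrowCoveringClaims.not_inertia_ε0_le_piXarrow_of_orientedInertia` (p438104) with its inputs `(hA, hO)`
  now supplied from the laws — `CuspGalois.not_inertia_ε0_le_piXarrow_of_modLCuspLaws`, binding only the laws
  and the ORIENTED-inertia inputs (gen)(rel)(inv).

HONEST FRAMING: implications between named hypothesis binders; nothing here asserts abc proved or refuted or
takes a side on [IUTchIII] Cor. 3.12; typed ≠ inhabited ≠ discharged.
-/

namespace Literature.IUT.HodgeTheaters

namespace PuncturedEllipticData

open scoped Pointwise
open Topology Literature.AnabelianGeometry.AbsoluteAnabelian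

universe u

variable {D : PuncturedEllipticData.{u}}

namespace CuspGalois

variable (C : D.CuspGalois)

include C in
/-- **[IUTchI] §1 p. 38, the openness clause `ArrowOpenClaims` DERIVED from the cusp action and the `Δ_ε`-level
laws** (no [AbsTopI] Prop. 2.2: (L0) replaces topological finite generation). ([IUTchI] §1 p.38)
[claim: Mochizuki2012, status: disputed] -/
theorem arrowOpenClaims_of_modLCuspLaws (h : D.ModLCuspLaws) (hι : ∃ c ∈ D.DeltaCbar, c ∉ D.DeltaXbar) :
    D.ArrowOpenClaims := by
  have hA := C.arrowCoveringClaims_of_modLCuspLaws h hι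
  refine ⟨D.isOpen_piXarrow_of hA.jKer_normal ?_ h.modLKer_relIndex_ne_zero (C.isClosed_decomp D.twoε),
    D.isOpen_piCarrow_of hA.jKer_normal ?_ h.modLKer_relIndex_ne_zero (C.isClosed_decomp D.twoε)⟩
  · rw [hA.piXarrow_relindex]; exact mul_ne_zero two_ne_zero D.l_ne_zero
  · rw [hA.piCarrow_relindex]; exact D.l_ne_zero

include C in
/-- **Cor. 1.2, the `ε⁰` clause from the laws and ORIENTED inertia**: `¬ I_{ε⁰} ⊆ Π_{X̲→}` given `ModLCuspLaws`,
a geometric `ι̲`, and topological generators `z_x ∈ I_x` with (gen) `I_{ε′} ⊆ closure ⟨z_{ε′}⟩`, (rel) the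
surface relation `∏ z_{e(i)} ∈ closure [Δ_X̲, Δ_X̲]`, (inv) `ι̲` carries `z_{ε′}` to `z_{ε″}` modulo
`Ker(Δ_X̲ ↠ Δ_X̲^{ab} ⊗ ℤ/l)` (abc-iut-L5-t1 gen 4, p438104, with `hA`, `hO` now derived).
([IUTchI] Cor 1.2 p.39) [claim: Mochizuki2012, status: disputed] -/
theorem not_inertia_ε0_le_piXarrow_of_modLCuspLaws (h : D.ModLCuspLaws)
    (hι : ∃ c ∈ D.DeltaCbar, c ∉ D.DeltaXbar) (z : D.Cusp → D.PiC) (hz : ∀ x, z x ∈ D.inertia x)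
    (hgen : D.inertia D.ε1 ≤ (Subgroup.zpowers (z D.ε1)).topologicalClosure)
    (hrel : ∃ (n : ℕ) (e : Fin n ≃ D.Cusp),
      (List.ofFn fun i => z (e i)).prod ∈ (⁅D.DeltaXbar, D.DeltaXbar⁆).topologicalClosure)
    (hinv : ∃ c ∈ D.PiCbar, c ∉ D.PiX ∧ ∃ t ∈ D.PiXbar,
      (t * c) * z D.ε1 * (t * c)⁻¹ * (z D.ε2)⁻¹ ∈ D.modLKer) :
    ¬ D.inertia D.ε0 ≤ D.piXarrow :=
  (C.arrowCoveringClaims_of_modLCuspLaws h hι).not_inertia_ε0_le_piXarrow_of_orientedInertia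
    (C.arrowOpenClaims_of_modLCuspLaws h hι) z hz hgen hrel hinv

end CuspGalois

end PuncturedEllipticData

/-! ### At an initial Θ-datum (Def. 3.1 (d), (f)) -/

namespace InitialThetaData

universe u' v w

variable {F : Type u'} {K : Type v} {Fbar : Type w} [Field F] [NumberField F] [Field K] [NumberField K]
  [Algebra F K] [Field Fbar] [Algebra F Fbar] [Algebra K Fbar]
  {E : WeierstrassCurve F} [E.IsElliptic] {l : ℕ} {Pb : BadPlacePredicates K}
  (D : InitialThetaData F K Fbar E l Pb)

/-- `ArrowOpenClaims` for the `K`-level datum `D.geom.pe` from the cusp action and the `Δ_ε`-level laws.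
([IUTchI] §1 p.38, Def 3.1 (f) p.63) [claim: Mochizuki2012, status: disputed] -/
theorem arrowOpenClaims_pe_of_modLCuspLaws (C : D.geom.pe.CuspGalois) (h : D.geom.pe.ModLCuspLaws) :
    D.geom.pe.ArrowOpenClaims :=
  C.arrowOpenClaims_of_modLCuspLaws h (D.geom.pe.exists_mem_deltaCbar_not_mem_deltaXbar
    D.geom.not_PiCbar_le_PiX D.geom.aug_PiXbar)

/-- **Def. 3.1 (f): `Π_{X̲→_K} ⊆ Π_{C_F}` is OPEN** from the cusp action and the `Δ_ε`-level laws (the binder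
`hX` of Ex. 3.3 at the datum / G-L5t2g4-1, with `hA` and `GeomTFG` replaced by `ModLCuspLaws`).
([IUTchI] Def 3.1 (f) p.63) [claim: Mochizuki2012, status: disputed] -/
theorem isOpen_PiXarrow_of_modLCuspLaws [IsScalarTower F K Fbar] (C : D.geom.pe.CuspGalois)
    (h : D.geom.pe.ModLCuspLaws) : IsOpen (D.PiXarrow : Set D.PiC) := by
  change IsOpen ((D.geom.pe.piXarrow.map D.geom.embK : Subgroup D.PiC) : Set D.PiC)
  rw [Subgroup.coe_map]
  exact D.isOpenEmbedding_embK.isOpenMap _ (D.arrowOpenClaims_pe_of_modLCuspLaws C h).isOpen_piXarrow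

/-- **Def. 3.1 (f): `Π_{C̲→_K} ⊆ Π_{C_F}` is OPEN** from the cusp action and the `Δ_ε`-level laws.
([IUTchI] Def 3.1 (f) p.63) [claim: Mochizuki2012, status: disputed] -/
theorem isOpen_PiCarrow_of_modLCuspLaws [IsScalarTower F K Fbar] (C : D.geom.pe.CuspGalois)
    (h : D.geom.pe.ModLCuspLaws) : IsOpen (D.PiCarrow : Set D.PiC) := by
  change IsOpen ((D.geom.pe.piCarrow.map D.geom.embK : Subgroup D.PiC) : Set D.PiC)
  rw [Subgroup.coe_map]
  exact D.isOpenEmbedding_embK.isOpenMap _ (D.arrowOpenClaims_pe_of_modLCuspLaws C h).isOpen_piCarrow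

end InitialThetaData

end Literature.IUT.HodgeTheaters
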